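import Literature.NumberTheory.NumberFields.ConductorLocalCriterion
import Literature.NumberTheory.ComplexMultiplication.EllipticUnits.KatoLayerArtinCompatibility
import HarnessLib

/-!
# `K(𝔞) ∩ K(𝔟) = K(gcd(𝔞, 𝔟))` for Shimura's ray class fields over a totally complex `K`

Cell `bsd-print-cf2`, WIDTH seat `bsd-line-cf2-p1-w5` g10 (prover-bsd-line-cf2-p1-w5-g10-0); plumbing lemma P2 of the (LZ) blueprint
(`Cruxes/SplitBadTwoRankOneOfFacts/LZ-BLUEPRINT-w5g10.md`) behind hZC (`TwistedZeta.hZC_of_levelwise`, p732796) on the DECIDING child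
stmt-BirchSwinnertonDyer-24721; `--supports` 24721 (helper, Theses-free, print-free). THEOREMS ONLY. HONEST FRAMING: a three-line corollary of the
tree's conductor criterion `le_rayClassField_iff_conductor_dvd` (hodge lane, Neukirch VI (6.4)–(6.5)); nothing closes the crux; no summit statement is
proved by this seat; BSD is not proved by any of this.

WHY (LZ) NEEDS IT. A Rubin generator of `F_m = K₀K̃_m` is `N_{F_mK(𝔣′)/F_m} Θ(τ; 𝔣′)`, an element of `F′ = F_m ∩ K(𝔣′)`; to norm de Shalit's theta
value from `K(𝔣′)` down to `M = K(𝔣′) ∩ K₀K̃_n ⊆ K(p^N𝔣)` THROUGH the ray class fields of the divisors of `𝔣′` (II.2.5 (i) is a statement about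
FULL ray-class norms `N_{K(𝔣𝔩)/K(𝔣)}`) one needs `M ⊆ K(gcd(𝔣′, p^N𝔣))`: an abelian `L` inside `K(𝔞)` and `K(𝔟)` has conductor dividing both,
hence dividing `gcd(𝔞, 𝔟) = 𝔞 ⊔ 𝔟`, hence lies in `K(𝔞 ⊔ 𝔟)`.

References: J. Neukirch, Algebraic Number Theory (1999) VI §6 (6.4)–(6.6); G. Shimura (1998) §18.6.
-/

noncomputable section

-- the summit namespace `Summit.BirchSwinnertonDyer.BirchSwinnertonDyer` repeats the problem name by design (D-0017)
set_option linter.dupNamespace false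
set_option autoImplicit false

open scoped NumberField
open Field IsDedekindDomain IntermediateField NumberField
open Literature.NumberTheory.NumberFields
open Literature.NumberTheory.ComplexMultiplication.EllipticUnits

namespace Summit.BirchSwinnertonDyer.BirchSwinnertonDyer.Theorems.PrintCf2.RayClassFieldMeet

variable {K : Type} [Field K] [NumberField K] [IsTotallyComplex K]

/-- **An abelian `L` inside `K(𝔞)` and inside `K(𝔟)` lies inside `K(𝔞 ⊔ 𝔟) = K(gcd(𝔞, 𝔟))`** (`K` totally complex; `𝔞, 𝔟 ≠ 0`): the conductor of
`L` divides `𝔞` and `𝔟`. [cite: NeukirchANT1999, Ch. VI §6 Def. (6.4) and Prop. (6.5), pp. 397–398] -/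
theorem le_rayClassField_sup_of_le (L : IntermediateField K (AlgebraicClosure K)) [NumberField L] [FiniteDimensional K L]
    [IsAbelianGalois K L] {𝔞 𝔟 : Ideal (𝓞 K)} (h𝔞 : 𝔞 ≠ ⊥) (h𝔟 : 𝔟 ≠ ⊥) (ha : L ≤ rayClassField K 𝔞)
    (hb : L ≤ rayClassField K 𝔟) : L ≤ rayClassField K (𝔞 ⊔ 𝔟) := by
  have hsup : 𝔞 ⊔ 𝔟 ≠ ⊥ := fun h ↦ h𝔞 (le_bot_iff.mp (h ▸ le_sup_left))
  rw [le_rayClassField_iff_conductor_dvd L hsup, Ideal.dvd_iff_le]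
  exact sup_le (Ideal.dvd_iff_le.mp ((le_rayClassField_iff_conductor_dvd L h𝔞).mp ha))
    (Ideal.dvd_iff_le.mp ((le_rayClassField_iff_conductor_dvd L h𝔟).mp hb))

/-- **`K(𝔞) ∩ K(𝔟) ≤ K(𝔞 ⊔ 𝔟)`** (`K` totally complex; `𝔞, 𝔟 ≠ 0`). [cite: NeukirchANT1999, Ch. VI §6 Def. (6.4) and Prop. (6.5), pp. 397–398] -/
theorem rayClassField_inf_le {𝔞 𝔟 : Ideal (𝓞 K)} (h𝔞 : 𝔞 ≠ ⊥) (h𝔟 : 𝔟 ≠ ⊥) :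
    rayClassField K 𝔞 ⊓ rayClassField K 𝔟 ≤ rayClassField K (𝔞 ⊔ 𝔟) := by
  haveI : FiniteDimensional K (rayClassField K 𝔞 ⊓ rayClassField K 𝔟 : IntermediateField K (AlgebraicClosure K)) :=
    FiniteDimensional.of_injective
      (IntermediateField.inclusion (inf_le_left : rayClassField K 𝔞 ⊓ rayClassField K 𝔟 ≤ rayClassField K 𝔞)).toLinearMap
      (IntermediateField.inclusion_injective (inf_le_left : rayClassField K 𝔞 ⊓ rayClassField K 𝔟 ≤ rayClassField K 𝔞))
  haveI : IsAbelianGalois K (rayClassField K 𝔞 ⊓ rayClassField K 𝔟 : IntermediateField K (AlgebraicClosure K)) :=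
    IsAbelianGalois.of_algHom (IntermediateField.inclusion (inf_le_left : rayClassField K 𝔞 ⊓ rayClassField K 𝔟 ≤ rayClassField K 𝔞))
  haveI : NumberField (rayClassField K 𝔞 ⊓ rayClassField K 𝔟 : IntermediateField K (AlgebraicClosure K)) := NumberField.of_module_finite K _
  exact le_rayClassField_sup_of_le _ h𝔞 h𝔟 inf_le_left inf_le_right

/-- **`K(𝔞) ∩ K(𝔟) = K(𝔞 ⊔ 𝔟)`** (`K` totally complex; `𝔞, 𝔟 ≠ 0`): the other inclusion is monotonicity (`𝔞, 𝔟 ≤ 𝔞 ⊔ 𝔟`).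
[cite: NeukirchANT1999, Ch. VI §6 Def. (6.4) and Prop. (6.5), pp. 397–398] -/
theorem rayClassField_inf_eq {𝔞 𝔟 : Ideal (𝓞 K)} (h𝔞 : 𝔞 ≠ ⊥) (h𝔟 : 𝔟 ≠ ⊥) :
    rayClassField K 𝔞 ⊓ rayClassField K 𝔟 = rayClassField K (𝔞 ⊔ 𝔟) :=
  le_antisymm (rayClassField_inf_le h𝔞 h𝔟)
    (le_inf (rayClassField_mono (rayUnitIdeles_anti_of_le h𝔞 le_sup_left)) (rayClassField_mono (rayUnitIdeles_anti_of_le h𝔟 le_sup_right)))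

/-- Pointwise form: `x ∈ K(𝔞)` and `x ∈ K(𝔟)` ⇒ `x ∈ K(𝔞 ⊔ 𝔟)`. [cite: NeukirchANT1999, Ch. VI §6 Def. (6.4) and Prop. (6.5), pp. 397–398] -/
theorem mem_rayClassField_sup {𝔞 𝔟 : Ideal (𝓞 K)} (h𝔞 : 𝔞 ≠ ⊥) (h𝔟 : 𝔟 ≠ ⊥) {x : AlgebraicClosure K}
    (ha : x ∈ rayClassField K 𝔞) (hb : x ∈ rayClassField K 𝔟) : x ∈ rayClassField K (𝔞 ⊔ 𝔟) :=
  rayClassField_inf_le h𝔞 h𝔟 (IntermediateField.mem_inf.mpr ⟨ha, hb⟩)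

end Summit.BirchSwinnertonDyer.BirchSwinnertonDyer.Theorems.PrintCf2.RayClassFieldMeet

end
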